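import Mathlib
import Summits.Ventures.PercRepro2.A3PendantFree
import Summits.Ventures.PercRepro2.A3RootEdgeMeans

/-!
# (FM) at the `Q`-centring: `FMfun = btwg(γ₀) − D · δ_b · δ_o` with `δ_v = P(v ∈ U | PD) − P(v ∈ U | Q)`
(blind cell PercRepro2, night-1 g34; proofs/NIGHT1-G34.md §2)

The first-order functional `FMfun` (A3PendantFree) and the means-level form at an explicit centring
`btwg` (A3RootEdgeMeans) share their `σ`-part when the centring is `γ₀ = P(Q, o ∈ U)/P(Q)`; they differ
only in the `PD`-part, which `FMfun` centres at the `Q`-means `m_v/P(Q)` and `btwg` at the `PD`-means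
`n_v/D` (`n_v = ∑_{W ∈ A} Su_v(W)`, `m_v = P(Q, v ∈ U)`).  The difference is the product of the two
"UU-defects" `δ_v = n_v/D − m_v/P(Q)`:

  **`FMfun = btwg γ₀ − D · δ_b · δ_o`**   (`FMfun_eq_btwg_sub`, pure algebra for `D ≠ 0`, `P(Q) ≠ 0`).

Hence (FM) follows from (MEANS-a₃) AT THE `Q`-CENTRING whenever the two UU-defects have opposite signs
(`FM_of_btwg_gamma0_of_mul_nonpos`).  After NEG-239 (the UU inequality `δ_o ≤ 0` is false in general)
this is the remaining exact bridge between the two conditions of the route.  Standard axioms.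
-/

namespace Summit.Ventures.PercRepro2

open UnionCluster CovForm

namespace CovForm

namespace A3Fibre

namespace FMDecomp

section Dual

variable {V : Type*} {E : Type*} [Fintype V] [DecidableEq V] [Fintype E] [DecidableEq E]
  {R : Type*} [Field R] [LinearOrder R] [IsStrictOrderedRing R] {ends : E → Sym2 V} {p : E → R}
  {o a₁ a₂ x b : V}

/-- The UU-defect of the mark `v` at the explored vertex `x`: `n_v/D − m_v/P(Q)`
(`= P(v ∈ U | PD) − P(v ∈ U | Q)` when `D, P(Q) ≠ 0`). -/
noncomputable def uuDefect (p : E → R) (ends : E → Sym2 V) (a₁ a₂ x v : V) : R :=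
  (∑ W ∈ fibresA a₁ a₂, Su p ends a₁ a₂ x v W) / prob p (PDEvent ends a₁ a₂ x) -
    LeafStep.mU p ends a₁ a₂ v / prob p (avoidAll ends a₂ {a₁})

omit [LinearOrder R] [IsStrictOrderedRing R] in
/-- **`FMfun = btwg(γ₀) − D · δ_b · δ_o`.** -/
theorem FMfun_eq_btwg_sub (hD : prob p (PDEvent ends a₁ a₂ x) ≠ 0)
    (hQ : prob p (avoidAll ends a₂ {a₁}) ≠ 0) :
    FMfun p ends o a₁ a₂ x b =
      RootEdge.btwg p ends o a₁ a₂ x b (gamma0 p ends o a₁ a₂) -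
        prob p (PDEvent ends a₁ a₂ x) * uuDefect p ends a₁ a₂ x b * uuDefect p ends a₁ a₂ x o := by
  unfold FMfun RootEdge.btwg uuDefect
  field_simp
  ring

/-- **(FM) from (MEANS-a₃) at the `Q`-centring when the UU-defects of `b` and `o` have opposite
signs**: `0 ≤ btwg γ₀` and `δ_b · δ_o ≤ 0` give `0 ≤ FMfun`. -/
theorem FM_of_btwg_gamma0_of_mul_nonpos (hp : IsProbVec p) (hD : prob p (PDEvent ends a₁ a₂ x) ≠ 0)
    (hQ : prob p (avoidAll ends a₂ {a₁}) ≠ 0)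
    (hb : 0 ≤ RootEdge.btwg p ends o a₁ a₂ x b (gamma0 p ends o a₁ a₂))
    (hδ : uuDefect p ends a₁ a₂ x b * uuDefect p ends a₁ a₂ x o ≤ 0) :
    FM p ends o a₁ a₂ x b := by
  unfold FM
  rw [FMfun_eq_btwg_sub hD hQ, mul_assoc]
  have hD0 : 0 ≤ prob p (PDEvent ends a₁ a₂ x) := prob_nonneg hp _
  nlinarith [mul_nonneg hD0 (neg_nonneg.mpr hδ)]

end Dual

end FMDecomp

end A3Fibre

end CovForm

end Summit.Ventures.PercRepro2
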